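import Literature.AlgebraicGeometry.Motives.ProjectiveOfGeneratingSections
import Summits.ResolutionOfSingularities.ResolutionOfSingularities.Theorems.EquisingularLiftEquisingularLiftIdealSheafPowMul
import HarnessLib

/-!
# `EquisingularLift` (stmt-ResolutionOfSingularities-15660), line `Sketch` v10b — extension of sections of an ideal sheaf
# to sections of `𝓛^{⊗d}` with values in the ideal sheaf on every chart (Step E of the STUB-PLAN)

[OURS · L1 W4.5b] Helper for the registered stub `stub_linearCentre_of_blowupModel` of the crux `EquisingularLift`; NOT a
statement of any manuscript.

Let `D` be generating-sections data on `Y` (`Literature.AlgebraicGeometry.Motives.GeneratingSections`: charts `U i = Y_{s_i}`,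
ratios `s_j/s_i`) with finitely many, affine charts, and `𝔞` a quasi-coherent ideal sheaf. For `a ∈ 𝔞(U i)` there is a global
section `t` of some `𝓛^{⊗d}` (chart form `GeneratingSections.Sec`) with `t/s_i^d = a` on `U i` AND `t/s_j^d ∈ 𝔞(U j)` for
EVERY `j`: extend `a ⊗ s_i^{⊗d₀}` by Hartshorne II.5.14 (`exists_sec_val_eq`), then multiply by `s_i^{⊗N}` for `N` clearing the
denominators (`exists_pow_mul_mem_ideal`, p479489): on `U j ∩ U i = (U j)_{s_i/s_j}` the value `t₀/s_j^{d₀}` is a unit multiple of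
`a`, hence in `𝔞`, so `(s_i/s_j)^N · t₀/s_j^{d₀} ∈ 𝔞(U j)`.
-/

set_option linter.dupNamespace false -- mandated namespace `Summit.<Summit>.<Problem>` of this single-conjunct summit

noncomputable section

open CategoryTheory AlgebraicGeometry TopologicalSpace
open Literature.AlgebraicGeometry.Motives
open Literature.AlgebraicGeometry.Motives.GeneratingSections

namespace Summit.ResolutionOfSingularities.ResolutionOfSingularities.Cruxes.EquisingularLift.StrataSplit

namespace LinearCentre

universe u

variable {ι : Type} {Y : Scheme.{u}} (D : GeneratingSections ι Y) [Finite ι] (hU : ∀ i, IsAffineOpen (D.U i))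
  (𝔞 : Y.IdealSheafData)

include hU in
/-- **Sections of an ideal sheaf extend to sections of `𝓛^{⊗d}` with all chart values in the ideal sheaf.** For
`a ∈ 𝔞(U i)` there are `d` and `t ∈ Γ(Y, 𝓛^{⊗d})` (chart form) with `t/s_i^d = a` and `t/s_j^d ∈ 𝔞(U j)` for all `j`.
[cite: Hartshorne1977, II Lemma 5.14] -/
theorem exists_sec_val_eq_mem_ideal (i : ι) (a : Γ(Y, D.U i)) (ha : a ∈ 𝔞.ideal ⟨D.U i, hU i⟩) :
    ∃ (d : ℕ) (t : D.Sec d), t.val i = a ∧ ∀ j, t.val j ∈ 𝔞.ideal ⟨D.U j, hU j⟩ := by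
  classical
  obtain ⟨d₀, t₀, ht₀⟩ := D.exists_sec_val_eq hU i a
  -- on `U j ∩ U i = (U j)_{s_i/s_j}` the value `t₀/s_j^{d₀}` is `a · (s_i/s_j)^{d₀}`, hence lies in `𝔞`
  have hres : ∀ j, Y.presheaf.map (homOfLE (Y.basicOpen_le (D.ratio j i))).op (t₀.val j) ∈
      𝔞.ideal (Y.affineBasicOpen (U := ⟨D.U j, hU j⟩) (D.ratio j i)) := by
    intro j
    have hc := t₀.compat' i j
    -- `rs (V_le_left j i) (t₀.val j) = rs (V_le_right j i) (t₀.val i) * rs _ (ratio j i) ^ d₀`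
    change rs (D.V_le_left j i) (t₀.val j) ∈ 𝔞.ideal (Y.affineBasicOpen (U := ⟨D.U j, hU j⟩) (D.ratio j i))
    rw [hc, ht₀]
    refine Ideal.mul_mem_right _ _ ?_
    have hmap := 𝔞.map_ideal (U := Y.affineBasicOpen (U := ⟨D.U j, hU j⟩) (D.ratio j i)) (V := ⟨D.U i, hU i⟩)
      (D.V_le_right j i)
    rw [← hmap]
    exact Ideal.mem_map_of_mem _ ha
  have hN : ∀ j, ∃ N : ℕ, D.ratio j i ^ N * t₀.val j ∈ 𝔞.ideal ⟨D.U j, hU j⟩ := fun j =>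
    exists_pow_mul_mem_ideal 𝔞 ⟨D.U j, hU j⟩ (D.ratio j i) (t₀.val j) (hres j)
  choose N hN using hN
  obtain ⟨M, hM⟩ : ∃ M, ∀ j, N j ≤ M := by
    haveI := Fintype.ofFinite ι
    exact ⟨Finset.univ.sup N, fun j ↦ Finset.le_sup (Finset.mem_univ j)⟩
  refine ⟨d₀ + M, t₀.mul (Sec.pow D i M), ?_, fun j => ?_⟩
  · rw [Sec.mul_val, Sec.pow_val, ht₀, D.ratio_self, one_pow, mul_one]
  · rw [Sec.mul_val, Sec.pow_val, mul_comm, ← Nat.sub_add_cancel (hM j), pow_add, mul_assoc]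
    exact Ideal.mul_mem_left _ _ (hN j)

end LinearCentre

end Summit.ResolutionOfSingularities.ResolutionOfSingularities.Cruxes.EquisingularLift.StrataSplit

end
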